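import Literature.MathematicalPhysics.QuantumFieldTheory.Balaban1983to89.B11Ineq190Actual
import Literature.MathematicalPhysics.QuantumFieldTheory.Balaban1983to89.B11AxialTransport190

/-!
# `Balaban1983to89.B11Response190OneBond` — T. Bałaban, *The variational problem and background fields in renormalization group method for
lattice gauge theories*, Commun. Math. Phys. **102** (1985) 277–309 [Balaban1985Variational], Sect. G ∕ Prop. 9 ∕ (190): **THE ONE-BLOCK
RESPONSE OF THE CHART `𝓗` TO A LOCALISED SOURCE — AT THE BASE POINT AND ALONG A SECOND DIRECTION — END TO END FROM THE SECT. G LEAVES**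

statement-level skeleton of published theorems with citation tags; proofs where landed; nothing here is a claim about the Yang–Mills mass gap.

CITATION HEADER (lean-in-tree rule 2026-08-18).  T. Bałaban, *The variational problem and background fields in renormalization group method for
lattice gauge theories*, Commun. Math. Phys. **102**, 277–309 (1985), doi:10.1007/BF01229381, bib `Balaban1985Variational` (cell paper B11; Prop. 9
p. 309, (190) p. 308, (179)–(180) p. 306, (172) p. 305).  PDF held: `paper:balaban1985-cmp102-variational-background` (journal page = PDF page + 276).
Consumers of (190) in print: [Balaban1988Convergent] p. 251 (B14), [Balaban1989LargeFieldI] §1 (B15), [Balaban1989LargeFieldII] (1.98)–(1.100)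
(B16).  Cell `ym3-torus` (YM₃ on T³, rung R3 — NOT d = 4, NOT infinite volume, NOT a mass gap, NOT Clay), width seat `ym-ust-20520-w5` g20, item
«(r1)-BRIDGE #15» named by LEAD w3-20520 g21 (2026-08-30 15:35Z) on w4-20520 g20's LOCATE `pub/ym3-torus/ym-ust-20520-w4/g20/LOCATE-r1-bridge.v1_1.w4g20.md`
(§2 steps 3–4, «run at COMPLEX `V′`»); `--kind proof`, no `def`, no new named fact.

THE PRINT.  (190) p. 308: *«|(δ∕δB_ν(y′))𝓗_μ(B,x)|, |∇_x(δ∕δB_ν(y′))𝓗_μ(B,x)|, … ≤ O(1)[(L^jη)^{−1}, (L^jη)^{−2}, …]·(L^{j′}η)^{−d} exp(−⅛δ₀d(y,y′)) (190)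
for x ∈ Δ(y) …»*; Prop. 9 p. 309: *«The function 𝓗(B) is determined by Eqs. (174), (175) … It is an analytic function of B … and its functional
derivative (182) satisfies the inequalities (190).»*  The consumers read (190) + «𝓗(0) = 0» + analyticity as: a source `B` LOCALISED in one
block `Δ(y_b)` produces a response `𝓗(B)` whose size on `Δ(y)` decays like `e^{−δ·d(y,y_b)}` ([Balaban1988Convergent] p. 251 *«|𝐇_{1,Ax}| <
O(1)B₃exp(−δMR₁)ε₁»*, typed at the level of shapes as `B11AxialTransport190.far_bound_sum` ∕ `far_bound_meanValue`).

WHAT THIS FILE PROVES (kernel-checked, zero `sorry`; theorems only; axioms standard; everything BY NAME from `B11Ineq190Actual` (r08 g10),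
`B11Presentation190` (p29 g9), `B11AxialTransport190` (the far-field sum), `B11Eq183Differentiation` (analyticity of the (179) chart)).
* §1 `loc_le_of_pair_localized` — abstract glue: the consumers' PAIR `(∀ t, Ineq190 bB bout (dH t) C δ₀)` ∧ `hmv` at `y`, a row sum at rate
  `δ₀∕16`, and a source `B` whose blocks of non-zero size lie at `d`-distance `≥ D` from `y` with sizes `≤ m` give `bout.loc y HB ≤ C·κ_B·c·m·e^{−(δ₀∕16)D}`
  (`hmv` fed with `far_bound_sum` at every `t`).
* §2 ★ **`response190_localized_sectG`** — THE ONE-BLOCK RESPONSE AT THE BASE POINT, from the located leaves of Sect. G only: the hypotheses of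
  `B11Ineq190Actual.ineq190_and_hmv_supSize_sectG` VERBATIM (regime (117)–(121), analyticity letters, `Tm 0 = 0`, the (180) domain condition on `B`,
  the lattice presentation `ev` with its compatibility letters, the located leaves `hG hD2H0 hH0 hH h189 hDfr hq`, (2.54) and Lemma 2.1 at rate `δ₀∕8`)
  plus a row sum at rate `δ₀∕16` and the localisation of `B` ⟹ `(supSize g box blk).loc y (Hl B) ≤ const190·κ_B·c₁₆·m·e^{−(δ₀∕16)·D}` for the presented
  chart `Hl B = (x ↦ ev x (𝓗(B)))`.
* §3 ★ **`response190_localized_increment_sectG`** — THE SAME ALONG A SECOND DIRECTION (base-point edition, NEW in the tree — every `hmv` so far runs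
  from `0`): for a base point `B₀` with `B₀` and `B₀ + B` in the (180) domain (the domain is convex: `H₀`, `Δ⁽²⁾H₀` are linear), the INCREMENT obeys
  `(supSize g box blk).loc y (Hl (B₀ + B) − Hl B₀) ≤ const190·κ_B·c₁₆·m·e^{−(δ₀∕16)·D}` — (190) at the points `B₀ + t•B` of the domain
  (`ineq190_sectG_dom`), transported to the sup size (`ineq190_postcomp_of_loc_le`), and the mean-value domination for the translated chart
  `Φ = 𝓗(B₀ + ·) − 𝓗(B₀)` (`Φ 0 = 0`; `hmv_supSize_of_differentiableAt`, differentiability from `analyticOnNhd_chartH179`).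
USE (20520, LINE g24-4 v2, the RESPONSE leaf RESPᵃ∘ of `Theorems/FluctuationComparisonRegPrIntLBackgroundFormCellResponseKnit`): §3 with `B₀ := z•B_b`
(`‖z‖ < Rw`, the complex one-bond move of the OTHER bond inside (172)'s ball) and `B := B_{b′}` is the abstract pre-image of the slice letter «the
`b′`-response is bounded by `σ_J·e^{−4μ·d(blk e, b′)}` UNIFORMLY along the complex `b`-move»; §2 is (r1) itself at the abstract level.  The T³
dictionary (minimiser map, gauge, norm rows ⇒ `HasMaj`) is NOT here (w4's LOCATE §3: XL, 19200-lane business after EX).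

HONEST SCOPE.  Compositions of landed theorems; the located leaves of Sect. G stay HYPOTHESES of printed shape — in particular (189) (`h189`, cell GAPS
G-B11-G2: *«We do not perform these calculations here»*) and the kernel letters of `G̃`, `H₀`, `H`, `𝔇`; the words *«and finally Proposition 2 and
(181)»* (G-B11-G2a) are not typed.  No lattice object of [4]–[6], no T³ object, no registry; NOT summit progress; the Yang–Mills mass gap is NOT proved.
-/

noncomputable section

namespace Literature.MathematicalPhysics.QuantumFieldTheory.Balaban1983to89.B11Response190OneBond

open Literature.MathematicalPhysics.QuantumFieldTheory.Balaban1983to89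
open B11SectG B11Eq174Chart B11Eq183Differentiation B11Presentation190 B11SupSize190 B11Ineq190Actual B11AxialTransport190
  B6RandomWalk Set Metric

/-! ## §1 Abstract glue: the consumers' pair + a localised source ⇒ the one-block response bound -/

section Pair

variable {g : B6.Geometry} {FB FA : Type} [AddCommGroup FB] [Module ℝ FB] [AddCommGroup FA] [Module ℝ FA]

/-- **THE PAIR + LOCALISATION ⇒ ONE-BLOCK RESPONSE.**  If every derivative functional `dH t` obeys (190) with constants `C, δ₀`, the value `HB`
is dominated by the common bounds of the `dH t B` near `y` (`hmv`), Lemma 2.1 [3] holds at rate `δ₀∕16`, and the source `B` has block sizes `≤ m`,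
non-zero only at `d`-distance `≥ D` from `y`, then `bout.loc y HB ≤ C·κ_B·c·m·e^{−(δ₀∕16)D}` (half the rate pays the distance, half the sum:
`B11AxialTransport190.far_bound_sum` at each `t`). [cite: Balaban1985Variational, Prop. 9 (190) pp.308-309; Balaban1988Convergent, p.251; Balaban1984PropagatorsII, Lemma 2.1 (2.61) p.234] -/
theorem loc_le_of_pair_localized {T : Type*} {bB : BlockNorm g FB} {bout : BlockNorm g FA} {dH : T → FB →ₗ[ℝ] FA}
    {C δ₀ D m c : ℝ} (h190 : ∀ t, Ineq190 bB bout (dH t) C δ₀) (hC : 0 ≤ C) (hδ : 0 ≤ δ₀)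
    (hrow : RowSum g (δ₀ / 16) c) {y : g.Site} {B : FB} (hm : 0 ≤ m)
    (hfar : ∀ y' : g.Site, bB.loc y' B ≠ 0 → D ≤ g.dist y y') (hsize : ∀ y' : g.Site, bB.loc y' B ≤ m)
    {HB : FA} (hmv : ∀ s : ℝ, (∀ t, bout.loc y (dH t B) ≤ s) → bout.loc y HB ≤ s) :
    bout.loc y HB ≤ C * bB.κ * c * m * Real.exp (-(δ₀ / 16 * D)) :=
  hmv _ fun t => far_bound_sum (h190 t) hC hδ hrow hm hfar hsize

end Pair

/-! ## §2 The one-block response at the base point, from the Sect. G leaves -/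

section SectG

variable {𝒳 𝒴 𝒵 : Type} [NormedAddCommGroup 𝒳] [NormedSpace ℂ 𝒳] [NormedAddCommGroup 𝒴] [NormedSpace ℂ 𝒴]
  [NormedAddCommGroup 𝒵] [NormedSpace ℂ 𝒵] [CompleteSpace 𝒳] [CompleteSpace 𝒴] [CompleteSpace 𝒵]
  {𝒢 : 𝒵 →L[ℂ] 𝒴} {W : 𝒴 → 𝒵} {D2 : 𝒴 →L[ℂ] 𝒵} {H₀ : 𝒳 →L[ℂ] 𝒴} {B₀ θ C₄ a₃ j a ε₄ : ℝ}
  {g : B6.Geometry}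
variable {X : Type} {E : Type} [NormedAddCommGroup E] [NormedSpace ℝ E] {box : g.Site → Finset X} {blk : X → g.Site}

/-- ★ **THE ONE-BLOCK RESPONSE OF `𝓗` AT THE BASE POINT, END TO END FROM THE LOCATED LEAVES OF SECT. G.**  Hypotheses = those of
`B11Ineq190Actual.ineq190_and_hmv_supSize_sectG` VERBATIM, plus Lemma 2.1 [3] at rate `δ₀∕16` (`hrow₁₆`) and the LOCALISATION of the source:
block sizes `bB.loc y′ B ≤ m`, non-zero only at `d`-distance `≥ D` from `y`.  Conclusion: the presented chart `Hl B = (x ↦ ev x (𝓗(B)))` has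
`(supSize g box blk).loc y (Hl B) ≤ const190·κ_B·c₁₆·m·e^{−(δ₀∕16)·D}` — the response to a source localised in one block decays exponentially in the
block distance: the shape every consumer of (190) uses ([Balaban1988Convergent] p. 251), and the abstract pre-image of the response row (r1) of cell
`ym3-torus`'s LINE g24-4. [cite: Balaban1985Variational, Prop. 9 (190) pp.308-309, (179)-(180) p.306; Balaban1988Convergent, p.251; Balaban1984PropagatorsII, Lemma 2.1 (2.61) p.234] -/
theorem response190_localized_sectG (R : Regime 𝒢 0 W B₀ θ C₄ a₃ j a ε₄) (hWa : AnalyticOnNhd ℂ W {Y : 𝒴 | ‖Y‖ < a₃})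
    {D : 𝒴 → 𝒳} (H : 𝒳 →L[ℂ] 𝒴) (hTm : AnalyticOnNhd ℂ (fun Y : 𝒴 => Y - H (D Y)) {Y : 𝒴 | ‖Y‖ < ε₄ + a})
    (hTm0 : (0 : 𝒴) - H (D 0) = 0)
    {B : 𝒳} (hB : ‖H₀ B‖ < a ∧ ‖D2 (H₀ B)‖ < j) (ev : X → (𝒴 →L[ℝ] E))
    {bB : BlockNorm g 𝒳} {bN : BlockNorm g 𝒴} {b3 : BlockNorm g 𝒵}
    (hev : ∀ (y : g.Site) (v : 𝒴), ∀ x ∈ box y, ‖ev x v‖ ≤ bN.loc y v)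
    (hN : ∀ (y : g.Site) (v : 𝒴), bN.loc y v ≤ ‖v‖) (hBloc : ∀ (y' : g.Site) (μ : 𝒳), bB.IsLoc y' μ → ‖μ‖ ≤ bB.loc y' μ)
    {δ₀ BG θW cΔ A₀ AH θD c : ℝ}
    (htri : Triangle254 g) (hd : ∀ a b : g.Site, 0 ≤ g.dist a b) (hδ₀ : 0 ≤ δ₀) (hrow : RowSum g (δ₀ / 8) c)
    (hc : 0 ≤ c) (hBG : 0 ≤ BG) (hθW : 0 ≤ θW) (hcΔ : 0 ≤ cΔ) (hA₀ : 0 ≤ A₀) (hAH : 0 ≤ AH) (hθD : 0 ≤ θD)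
    (hG : HasMaj b3 bN (𝒢.restrictScalars ℝ : 𝒵 →ₗ[ℝ] 𝒴) (fun y y' => BG * Real.exp (-(δ₀ * g.dist y y'))))
    (hD2H0 : HasMaj bB b3 ((D2 ∘L H₀).restrictScalars ℝ : 𝒳 →ₗ[ℝ] 𝒵) (fun y y' => cΔ * Real.exp (-(δ₀ * g.dist y y'))))
    (hH0 : HasMaj bB bN (H₀.restrictScalars ℝ : 𝒳 →ₗ[ℝ] 𝒴) (fun y y' => A₀ * Real.exp (-(δ₀ * g.dist y y'))))
    (hH : HasMaj bB bN (H.restrictScalars ℝ : 𝒳 →ₗ[ℝ] 𝒴) (fun y y' => AH * Real.exp (-(δ₀ / 2 * g.dist y y'))))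
    (h189 : ∀ B' : 𝒳, ‖H₀ B'‖ < a → ‖D2 (H₀ B')‖ < j →
      Ineq189 bN b3 ((fderiv ℂ W (solA180 𝒢 W D2 H₀ ε₄ B' + H₀ B')).restrictScalars ℝ : 𝒴 →ₗ[ℝ] 𝒵) θW δ₀)
    (hDfr : ∀ B' : 𝒳, ‖H₀ B'‖ < a → ‖D2 (H₀ B')‖ < j →
      ∃ 𝔇 : 𝒴 →L[ℂ] 𝒳, HasFDerivAt D 𝔇 (solA180 𝒢 W D2 H₀ ε₄ B' + H₀ B') ∧
        HasMaj bN bB (𝔇.restrictScalars ℝ : 𝒴 →ₗ[ℝ] 𝒳) (fun y y' => θD * Real.exp (-(δ₀ / 2 * g.dist y y'))))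
    (hq : qG b3.κ bN.κ BG θW c < 1)
    (Hl : 𝒳 → X → E) (dH : Icc (0:ℝ) 1 → 𝒳 →ₗ[ℝ] (X → E))
    (hHl : ∀ B' : 𝒳, Hl B' = fun x => ev x (chartH179 𝒢 W D2 H₀ (fun Y : 𝒴 => Y - H (D Y)) ε₄ B'))
    (hdH : ∀ t : Icc (0:ℝ) 1, dH t = (LinearMap.pi fun x => ((ev x : 𝒴 →L[ℝ] E) : 𝒴 →ₗ[ℝ] E)) ∘ₗ
      ((fderiv ℂ (chartH179 𝒢 W D2 H₀ (fun Y : 𝒴 => Y - H (D Y)) ε₄) ((t : ℝ) • B)).restrictScalars ℝ : 𝒳 →ₗ[ℝ] 𝒴))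
    {c₁₆ m Dd : ℝ} (hrow₁₆ : RowSum g (δ₀ / 16) c₁₆) (hm : 0 ≤ m) (y : g.Site)
    (hfar : ∀ y' : g.Site, bB.loc y' B ≠ 0 → Dd ≤ g.dist y y') (hsize : ∀ y' : g.Site, bB.loc y' B ≤ m) :
    (supSize g box blk : BlockNorm g (X → E)).loc y (Hl B) ≤
      const190 bB.κ bN.κ b3.κ BG θW cΔ A₀ AH θD c * bB.κ * c₁₆ * m * Real.exp (-(δ₀ / 16 * Dd)) := by
  obtain ⟨h190, hmv⟩ := ineq190_and_hmv_supSize_sectG R hWa H hTm hTm0 hB ev hev hN hBloc htri hd hδ₀ hrow hc hBG hθW hcΔ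
    hA₀ hAH hθD hG hD2H0 hH0 hH h189 hDfr hq Hl dH hHl hdH y
  have hC : 0 ≤ const190 bB.κ bN.κ b3.κ BG θW cΔ A₀ AH θD c := by
    have hκB := bB.κ_nonneg; have hκN := bN.κ_nonneg; have hκ₃ := b3.κ_nonneg
    unfold const190
    have h₁ := constA0_nonneg (cΔ := cΔ) hκ₃ hκN hBG hθW hcΔ hA₀ hc hq
    positivity
  exact loc_le_of_pair_localized h190 hC hδ₀ hrow₁₆ hm hfar hsize hmv

/-! ## §3 The one-block response along a second direction: the base-point (increment) edition -/

omit [CompleteSpace 𝒳] [CompleteSpace 𝒴] [CompleteSpace 𝒵] in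
/-- Strict sub-level sets of the norm of a linear map are convex along segments: `‖f B₀‖ < r`, `‖f (B₀ + B)‖ < r` ⟹ `‖f (B₀ + t•B)‖ < r`,
`t ∈ [0,1]`. [cite: Balaban1985Variational, (180) p.306] -/
theorem norm_lt_on_segment {F : Type*} [NormedAddCommGroup F] [NormedSpace ℂ F] (f : 𝒳 →L[ℂ] F) {B₀' B : 𝒳} {r : ℝ}
    (h0 : ‖f B₀'‖ < r) (h1 : ‖f (B₀' + B)‖ < r) {t : ℝ} (ht : t ∈ Icc (0:ℝ) 1) : ‖f (B₀' + t • B)‖ < r := by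
  have hsplit : f (B₀' + t • B) = (1 - t) • f B₀' + t • f (B₀' + B) := by
    rw [map_add, map_add, f.map_smul_of_tower, smul_add, sub_smul, one_smul]; abel
  rw [hsplit]
  rcases eq_or_lt_of_le ht.1 with h0t | h0t
  · rw [← h0t]; simpa using h0
  calc ‖(1 - t) • f B₀' + t • f (B₀' + B)‖ ≤ ‖(1 - t) • f B₀'‖ + ‖t • f (B₀' + B)‖ := norm_add_le _ _
    _ = (1 - t) * ‖f B₀'‖ + t * ‖f (B₀' + B)‖ := by
        rw [norm_smul, norm_smul, Real.norm_eq_abs, Real.norm_eq_abs, abs_of_nonneg (by linarith [ht.2]), abs_of_nonneg ht.1]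
    _ < (1 - t) * r + t * r := by
        have h1' : t * ‖f (B₀' + B)‖ < t * r := mul_lt_mul_of_pos_left h1 h0t
        have h0' : (1 - t) * ‖f B₀'‖ ≤ (1 - t) * r := mul_le_mul_of_nonneg_left h0.le (by linarith [ht.2])
        linarith
    _ = r := by ring

omit [CompleteSpace 𝒳] [CompleteSpace 𝒴] [CompleteSpace 𝒵] in
/-- The (180) domain `{‖H₀B′‖ < a ∧ ‖Δ⁽²⁾H₀B′‖ < j}` is CONVEX along segments: if `B₀` and `B₀ + B` lie in it, so does `B₀ + t•B`, `t ∈ [0,1]`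
(`H₀`, `Δ⁽²⁾H₀` linear). [cite: Balaban1985Variational, (180) p.306] -/
theorem dom180_segment {B₀' B : 𝒳} (hB₀ : ‖H₀ B₀'‖ < a ∧ ‖D2 (H₀ B₀')‖ < j) (hB₁ : ‖H₀ (B₀' + B)‖ < a ∧ ‖D2 (H₀ (B₀' + B))‖ < j)
    {t : ℝ} (ht : t ∈ Icc (0:ℝ) 1) : ‖H₀ (B₀' + t • B)‖ < a ∧ ‖D2 (H₀ (B₀' + t • B))‖ < j := by
  refine ⟨norm_lt_on_segment H₀ hB₀.1 hB₁.1 ht, ?_⟩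
  have := norm_lt_on_segment (D2 ∘L H₀) (B₀' := B₀') (B := B) (r := j) (by simpa using hB₀.2) (by simpa using hB₁.2) ht
  simpa using this

/-- ★ **THE ONE-BLOCK RESPONSE ALONG A SECOND DIRECTION (BASE-POINT EDITION).**  Same located leaves as §2; a base point `B₀` with `B₀` and
`B₀ + B` in the (180) domain; the derivative family along the translated segment `dH t = (x ↦ ev x) ∘ D𝓗(B₀ + t•B)`; `B` localised as in §2.
Conclusion: the INCREMENT of the presented chart obeys `(supSize g box blk).loc y (Hl (B₀ + B) − Hl B₀) ≤ const190·κ_B·c₁₆·m·e^{−(δ₀∕16)·D}` — the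
SAME bound, uniformly in the base point.  Proof: (190) at the interior points `B₀ + t•B` (`ineq190_sectG_dom`, convexity `dom180_segment`),
transported to the sup size (`ineq190_postcomp_of_loc_le`); mean-value domination for the translated chart `Φ = 𝓗(B₀ + ·) − 𝓗(B₀)`, `Φ 0 = 0`
(`hmv_supSize_of_differentiableAt`; differentiability from `analyticOnNhd_chartH179`, `fderiv Φ (t•B) = D𝓗(B₀ + t•B)` by `fderiv_sub_const` ∕
`fderiv_comp_add_left`); then §1.  Print: Prop. 9 states (190) for the derivative at EVERY point of the analyticity ball — this is its use «at complex
`V′`» (w4's LOCATE §2 step 4), i.e. the first-order response bound UNIFORM along a second (complex) move.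
[cite: Balaban1985Variational, Prop. 9 (190) pp.308-309, (179)-(180) p.306, (172) p.305; Balaban1988Convergent, p.251; Balaban1984PropagatorsII, Lemma 2.1 (2.61) p.234] -/
theorem response190_localized_increment_sectG (R : Regime 𝒢 0 W B₀ θ C₄ a₃ j a ε₄) (hWa : AnalyticOnNhd ℂ W {Y : 𝒴 | ‖Y‖ < a₃})
    {D : 𝒴 → 𝒳} (H : 𝒳 →L[ℂ] 𝒴) (hTm : AnalyticOnNhd ℂ (fun Y : 𝒴 => Y - H (D Y)) {Y : 𝒴 | ‖Y‖ < ε₄ + a})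
    {B₀' B : 𝒳} (hB₀ : ‖H₀ B₀'‖ < a ∧ ‖D2 (H₀ B₀')‖ < j) (hB₁ : ‖H₀ (B₀' + B)‖ < a ∧ ‖D2 (H₀ (B₀' + B))‖ < j)
    (ev : X → (𝒴 →L[ℝ] E))
    {bB : BlockNorm g 𝒳} {bN : BlockNorm g 𝒴} {b3 : BlockNorm g 𝒵}
    (hev : ∀ (y : g.Site) (v : 𝒴), ∀ x ∈ box y, ‖ev x v‖ ≤ bN.loc y v)
    (hN : ∀ (y : g.Site) (v : 𝒴), bN.loc y v ≤ ‖v‖) (hBloc : ∀ (y' : g.Site) (μ : 𝒳), bB.IsLoc y' μ → ‖μ‖ ≤ bB.loc y' μ)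
    {δ₀ BG θW cΔ A₀ AH θD c : ℝ}
    (htri : Triangle254 g) (hd : ∀ a b : g.Site, 0 ≤ g.dist a b) (hδ₀ : 0 ≤ δ₀) (hrow : RowSum g (δ₀ / 8) c)
    (hc : 0 ≤ c) (hBG : 0 ≤ BG) (hθW : 0 ≤ θW) (hcΔ : 0 ≤ cΔ) (hA₀ : 0 ≤ A₀) (hAH : 0 ≤ AH) (hθD : 0 ≤ θD)
    (hG : HasMaj b3 bN (𝒢.restrictScalars ℝ : 𝒵 →ₗ[ℝ] 𝒴) (fun y y' => BG * Real.exp (-(δ₀ * g.dist y y'))))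
    (hD2H0 : HasMaj bB b3 ((D2 ∘L H₀).restrictScalars ℝ : 𝒳 →ₗ[ℝ] 𝒵) (fun y y' => cΔ * Real.exp (-(δ₀ * g.dist y y'))))
    (hH0 : HasMaj bB bN (H₀.restrictScalars ℝ : 𝒳 →ₗ[ℝ] 𝒴) (fun y y' => A₀ * Real.exp (-(δ₀ * g.dist y y'))))
    (hH : HasMaj bB bN (H.restrictScalars ℝ : 𝒳 →ₗ[ℝ] 𝒴) (fun y y' => AH * Real.exp (-(δ₀ / 2 * g.dist y y'))))
    (h189 : ∀ B' : 𝒳, ‖H₀ B'‖ < a → ‖D2 (H₀ B')‖ < j →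
      Ineq189 bN b3 ((fderiv ℂ W (solA180 𝒢 W D2 H₀ ε₄ B' + H₀ B')).restrictScalars ℝ : 𝒴 →ₗ[ℝ] 𝒵) θW δ₀)
    (hDfr : ∀ B' : 𝒳, ‖H₀ B'‖ < a → ‖D2 (H₀ B')‖ < j →
      ∃ 𝔇 : 𝒴 →L[ℂ] 𝒳, HasFDerivAt D 𝔇 (solA180 𝒢 W D2 H₀ ε₄ B' + H₀ B') ∧
        HasMaj bN bB (𝔇.restrictScalars ℝ : 𝒴 →ₗ[ℝ] 𝒳) (fun y y' => θD * Real.exp (-(δ₀ / 2 * g.dist y y'))))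
    (hq : qG b3.κ bN.κ BG θW c < 1)
    (Hl : 𝒳 → X → E) (dH : Icc (0:ℝ) 1 → 𝒳 →ₗ[ℝ] (X → E))
    (hHl : ∀ B' : 𝒳, Hl B' = fun x => ev x (chartH179 𝒢 W D2 H₀ (fun Y : 𝒴 => Y - H (D Y)) ε₄ B'))
    (hdH : ∀ t : Icc (0:ℝ) 1, dH t = (LinearMap.pi fun x => ((ev x : 𝒴 →L[ℝ] E) : 𝒴 →ₗ[ℝ] E)) ∘ₗ
      ((fderiv ℂ (chartH179 𝒢 W D2 H₀ (fun Y : 𝒴 => Y - H (D Y)) ε₄) (B₀' + (t : ℝ) • B)).restrictScalars ℝ : 𝒳 →ₗ[ℝ] 𝒴))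
    {c₁₆ m Dd : ℝ} (hrow₁₆ : RowSum g (δ₀ / 16) c₁₆) (hm : 0 ≤ m) (y : g.Site)
    (hfar : ∀ y' : g.Site, bB.loc y' B ≠ 0 → Dd ≤ g.dist y y') (hsize : ∀ y' : g.Site, bB.loc y' B ≤ m) :
    (supSize g box blk : BlockNorm g (X → E)).loc y (Hl (B₀' + B) - Hl B₀') ≤
      const190 bB.κ bN.κ b3.κ BG θW cΔ A₀ AH θD c * bB.κ * c₁₆ * m * Real.exp (-(δ₀ / 16 * Dd)) := by
  set 𝓗 : 𝒳 → 𝒴 := chartH179 𝒢 W D2 H₀ (fun Y : 𝒴 => Y - H (D Y)) ε₄ with h𝓗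
  -- (190) for the actual derivative at every point of the domain
  have h190Y := ineq190_sectG_dom R hWa H hN hBloc htri hd hδ₀ hrow hc hBG hθW hcΔ hA₀ hAH hθD hG hD2H0 hH0 hH h189 hDfr hq
  -- (i) the derivative family along the translated segment obeys (190) into the sup size
  have h190 : ∀ t : Icc (0:ℝ) 1, Ineq190 bB (supSize g box blk : BlockNorm g (X → E)) (dH t)
      (const190 bB.κ bN.κ b3.κ BG θW cΔ A₀ AH θD c) δ₀ := by
    intro t
    rw [hdH t]
    have hdom := dom180_segment (H₀ := H₀) (D2 := D2) hB₀ hB₁ t.2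
    exact ineq190_postcomp_of_loc_le (LinearMap.pi fun x => ((ev x : 𝒴 →L[ℝ] E) : 𝒴 →ₗ[ℝ] E))
      (fun y v => supSize_loc_pi_le' (fun x => ((ev x : 𝒴 →L[ℝ] E) : 𝒴 →ₗ[ℝ] E)) hev y v) (h190Y _ hdom.1 hdom.2)
  -- (ii) the translated chart `Φ = 𝓗(B₀ + ·) − 𝓗(B₀)` and its mean-value domination
  set Φ : 𝒳 → 𝒴 := fun B' => 𝓗 (B₀' + B') - 𝓗 B₀' with hΦ
  have hΦ0 : Φ 0 = 0 := by simp [hΦ]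
  have hdiff : ∀ t ∈ Icc (0:ℝ) 1, DifferentiableAt ℂ 𝓗 (B₀' + t • B) := fun t ht =>
    ((analyticOnNhd_chartH179 R hWa hTm) (B₀' + t • B) (dom180_segment (H₀ := H₀) (D2 := D2) hB₀ hB₁ ht)).differentiableAt
  have hΦd : ∀ t ∈ Icc (0:ℝ) 1, DifferentiableAt ℂ Φ (t • B) := by
    intro t ht
    have h1 : DifferentiableAt ℂ (fun B' : 𝒳 => 𝓗 (B₀' + B')) (t • B) :=
      (hdiff t ht).comp (t • B) ((differentiableAt_const B₀').add differentiableAt_id)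
    exact h1.sub_const _
  have hfd : ∀ t ∈ Icc (0:ℝ) 1, fderiv ℂ Φ (t • B) = fderiv ℂ 𝓗 (B₀' + t • B) := by
    intro t ht
    rw [hΦ, fderiv_sub_const, fderiv_comp_add_left]
  have hmv := hmv_supSize_of_differentiableAt (box := box) (blk := blk) hΦ0 hΦd ev (fun B' => fun x => ev x (Φ B')) dH
    (fun B' => rfl) (fun t x => by rw [hdH t, hfd t t.2]; rfl) y
  -- (iii) the increment is the presented value of `Φ` at `B`
  have hval : (fun x => ev x (Φ B)) = Hl (B₀' + B) - Hl B₀' := by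
    rw [hHl (B₀' + B), hHl B₀']
    funext x
    simp [hΦ, map_sub]
  rw [← hval]
  have hC : 0 ≤ const190 bB.κ bN.κ b3.κ BG θW cΔ A₀ AH θD c := by
    have hκB := bB.κ_nonneg; have hκN := bN.κ_nonneg; have hκ₃ := b3.κ_nonneg
    unfold const190
    have h₁ := constA0_nonneg (cΔ := cΔ) hκ₃ hκN hBG hθW hcΔ hA₀ hc hq
    positivity
  exact loc_le_of_pair_localized h190 hC hδ₀ hrow₁₆ hm hfar hsize hmv

end SectG

end Literature.MathematicalPhysics.QuantumFieldTheory.Balaban1983to89.B11Response190OneBond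

end
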